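import Summits.QuantumFields.YangMills.Theorems.UnitScaleTiltProp7MassiveColumnSupBound
import Summits.QuantumFields.YangMills.Theorems.UnitScaleTiltProp7MassivePropagatorTail
import Summits.QuantumFields.YangMills.Theorems.UnitScaleTiltProp7BlockDistanceWeights
import HarnessLib

/-!
# Route `UnitScaleTilt`, crux K1 «MinimiserStabilityRegPr» (stmt-QuantumFields-19200), EX face after S45 — **(L3′b)-VALUE FILE V4a: THE TWO DECAY LETTERS OF THE
# LOD COLUMNS `ψ_y = G_a(Q″†(δ_y ⊗ Y))` IN BLOCK CURRENCY** — (D-E) the `L²` BLOCK DECAY `‖𝟙_{B(z)}ψ_y‖ ≤ C_col·e^{−μ·tdist(z,y)}·‖Y‖` and (D-P) the BLOCK-LOCAL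
# pointwise penalty `‖(a·Q″†Q″ψ_y)(x)‖ ≤ p_B·‖𝟙_{B(x)}ψ_y‖` — the inputs of V4b (the decayed pointwise column bound through w5's V3 ✓`Prop7KatoBootstrapMemberDecay`)
# (★★OWNER RULING №35-A∕B; chair ★`ym-ust-19200-p1` g25's pen V4, CHAIR WORD №4 (c))

Cell `ym3-torus` (HUMAN RULING D-0037; rung R3 = SU(2) YM₃ on T³ — NOT d = 4, NOT infinite volume, NOT a mass gap, NOT Clay).
THEOREMS ONLY (0 `def`, 0 `sorry`, default heartbeats); `--supports stmt-QuantumFields-19200 --as helper`; count-neutral.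

ENGINES (all landed): px5's (L3′a) tail ✓`Prop7MassivePropagatorTail.norm_tail_le_of_massive_eq` (Agmon∕Combes–Thomas in weighted `L²`) read against routeR-w2's block-distance phase
✓`Prop7BlockDistanceWeights.exists_blockDistanceWeight` (slope `μη` per bond, `= 0` on `B(y)`, `≥ μ(tdist z y − 3)` on `B(z)`); the block locality of `Q″†Q″`
(routeR-w2 ✓`Prop7TopMeanAdjointBlockLocal.adjoint_topMean_cut_comm`) and V2's spike test ✓`Prop7MassivePropagatorSupBound.norm_equiv_adjoint_apply_le`.
WHAT IS PROVED (ns `Summit.QuantumFields.YangMills.Theorems.Prop7MassiveColumnBlockDecay`; letters `hseq hι hT`, `G hAG` VERBATIM as in V2∕V2b; the Agmon window `hδ hwin` of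
✓`norm_tail_le_of_massive_eq` at `θ := μη`, `θ′ := 3μ` DISPLAYED — routeR-w4's ✓`Prop7LODSlotK2WindowLetters` closes it with its `μ(am)`).
* §1 `norm_adjoint_apply_le` (`‖T g‖ ≤ √s·‖g‖`, `s = (25∕8)c₁ℓ⁻³∕c₀`, duality over ✓`norm_lift_topMean_le`), `norm_column_source_le` (`‖Q″†(δ_y⊗Y)‖ ≤ √s·√(2c₁)·‖Y‖`).
* §2 ★★★ `norm_blockCut_massiveColumn_le` — (D-E): for every coarse `z`, `‖toL2S(𝟙_{B(z)}·ψ_y)‖ ≤ e^{−μ(tdist z y − 3)}·8C_P²·√s·√(2c₁)·‖Y‖` (`C_P² = max 2 (16c₀ℓ³∕(a c₁))`).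
* §3 ★★ `norm_equiv_penalty_apply_le_blockCut` — (D-P): for EVERY `u`, `‖(a·T(ι(Q″u)))(x)‖_{W₂} ≤ a·(5∕4)√(2c₁)∕(c₀ℓ³)·√s·‖toL2S(𝟙_{B(x)}·u)‖` (block-local — the lit letter
  `p₂‖P_{πx}v‖` of ✓`B9Eq342GreenPrimeSupBoundDecay`); ★★ `norm_equiv_penalty_column_le` — §3 ∘ §2: the penalty along a column DECAYS, `≤ p_B·C_col·e^{−μ(tdist(B(x), y) − 3)}·‖Y‖`.
HONEST SCOPE.  Composition of landed rows; CONDITIONAL on the LOD letters, `RegPr`, and the displayed Agmon window; no pointwise decay yet (V4b), no gradient; nothing of the ten EX rows,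
`hT`, `hGF`, EX or the crux is proved here.

References: T. Bałaban, CMP **99** (1985) 389–434 [Balaban1985BackgroundPropagators] (Thm 3.1 (3.42)∕(3.46) pp.397–398, (3.24) p.394, (3.49) p.399); J.-M. Combes, L. Thomas,
CMP **34** (1973) 251–270 [CombesThomas1973] (Lemma 1 p.255).
-/

set_option autoImplicit false

noncomputable section

open scoped BigOperators Matrix.Norms.L2Operator InnerProductSpace ComplexConjugate

namespace Summit.QuantumFields.YangMills.Theorems.Prop7MassiveColumnBlockDecay

open Literature.MathematicalPhysics.QuantumFieldTheory.Balaban1983to89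
open Finset
open T4Continuum BlockAveraging
open BlockAveraging (Idx)
open B7Prop1Explicit (U1 disp)
open B5Eq118OneStroke (iterBlockOf iterBlock mem_iterBlock)
open B10Eq27TorusAxialLog (holT transl)
open B7TransferAnalyticMean (meanCLM)
open B4Sect5Torus (TSite)
open B9Eq311L2Pairing (WL2)
open B11Eq103H1Complex (SiteL2K BondL2K)
open Summit.QuantumFields.YangMills.Theorems.Prop8Chart (emlIterU)
open Literature.MathematicalPhysics.QuantumFieldTheory.Balaban1983to89.T3ContinuumYM3Torus
open T3SectALandauChart (eta eta_pos bgUnits)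
open T3PrintedRegularMinimiser (RegPr)
open T3PrintedRegularOrbits (sites_eq)
open T3LevelShift (siteShift)
open Summit.QuantumFields.YangMills.Theorems.Prop7SectET3Transport (periodsT3 siteEquiv)
open Summit.QuantumFields.YangMills.Theorems.Prop7SectET3HilbertLetters (W₂ frobEquiv toL2S covLapSite toL2S_apply toL2S_symm_apply)
open Summit.QuantumFields.YangMills.Theorems.Prop7ComplementaryProjectorBlockDecay (norm_lift_topMean_le inner_lift_eq_zero_of_disjoint)
open Summit.QuantumFields.YangMills.Theorems.Prop7TopMeanAdjointBlockLocal (adjoint_apply_eq_zero_off_block adjoint_topMean_cut_comm)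
open Summit.QuantumFields.YangMills.Theorems.Prop7MassivePropagatorSupBound (norm_equiv_adjoint_apply_le)
open Summit.QuantumFields.YangMills.Theorems.Prop7MassiveColumnSupBound (norm_lift_single_le)
open Summit.QuantumFields.YangMills.Theorems.Prop7MassivePropagatorTail (norm_tail_le_of_massive_eq)
open Summit.QuantumFields.YangMills.Theorems.Prop7BlockDistanceWeights (exists_blockDistanceWeight)

variable (F : T3Family) {n K : ℕ} (h : n ≤ K) {c₀ c₁ : ℝ} [Fact (0 < c₀)] [Fact (0 < c₁)]
  {ε₀ : ℝ} (hε₀ : 0 < ε₀) (hε7 : 10 ^ 7 * (F.L : ℝ) ^ 3 * ε₀ ≤ 1)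
  (U₀ : GaugeField (F.P K) 0 (Matrix.specialUnitaryGroup (Fin 2) ℂ)) (hreg : RegPr F n K ε₀ U₀)
  (Q'' : SiteL2K ℂ 3 (periodsT3 F K) c₀ W₂ →ₗ[ℂ] (Site (F.P K) (K - n) → Matrix (Fin 2) (Fin 2) ℂ))
  (hseq : ∀ lam : Site (F.P K) 0 → Matrix (Fin 2) (Fin 2) ℂ, ∃ ns : (j : ℕ) → Site (F.P K) j → Matrix (Fin 2) (Fin 2) ℂ, ns 0 = lam ∧
      (∀ (j : ℕ) (y : Site (F.P K) (j + 1)), ns (j + 1) y = ns j (emb y) - meanCLM (Idx (F.P K)) (Matrix (Fin 2) (Fin 2) ℂ) fun i : Idx (F.P K) =>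
        ns j (emb y) - ((holT (emlIterU j (bgUnits F K U₀)) (emb y) (stairWord i.2.1 (off i.1)) : (Matrix (Fin 2) (Fin 2) ℂ)ˣ) : Matrix (Fin 2) (Fin 2) ℂ) *
          ns j (transl (emb y) (disp (stairWord i.2.1 (off i.1)))) * (((holT (emlIterU j (bgUnits F K U₀)) (emb y) (stairWord i.2.1 (off i.1)))⁻¹ : (Matrix (Fin 2) (Fin 2) ℂ)ˣ) : Matrix (Fin 2) (Fin 2) ℂ)) ∧
      ns (K - n) = Q'' (toL2S F K c₀ lam))
  (ι : (Site (F.P K) (K - n) → Matrix (Fin 2) (Fin 2) ℂ) →ₗ[ℂ] SiteL2K ℂ 3 (periodsT3 F n) c₁ W₂)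
  (hι : ∀ c, ι c = toL2S F n c₁ (fun z => c (siteShift (sites_eq F n K h) z)))
  (T : SiteL2K ℂ 3 (periodsT3 F n) c₁ W₂ →ₗ[ℂ] SiteL2K ℂ 3 (periodsT3 F K) c₀ W₂)
  (hT : ∀ (l : SiteL2K ℂ 3 (periodsT3 F K) c₀ W₂) (f : SiteL2K ℂ 3 (periodsT3 F n) c₁ W₂), ⟪ι (Q'' l), f⟫_ℂ = ⟪l, T f⟫_ℂ)
  {a : ℝ} (ha : 0 < a)

/-! ## §1 Sizes of the adjoint and of the column source in `L²` -/

include hε₀ hε7 hreg hseq hι hT in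
/-- **`‖T g‖ ≤ √s·‖g‖`**, `s = (25∕8)·c₁ℓ⁻³∕c₀` — duality (`‖Tg‖² = re⟪ι(Q″(Tg)), g⟫ ≤ ‖ι(Q″(Tg))‖‖g‖`) over ✓`norm_lift_topMean_le`.
[cite: Balaban1985BackgroundPropagators, (3.16) p.393, (3.24) p.394] -/
theorem norm_adjoint_apply_le (g : SiteL2K ℂ 3 (periodsT3 F n) c₁ W₂) :
    ‖T g‖ ≤ Real.sqrt ((25 / 8) * (c₁ * ((((F.P K).L : ℝ) ^ (F.P K).d) ^ (K - n))⁻¹ / c₀)) * ‖g‖ := by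
  set CT : ℝ := Real.sqrt ((25 / 8) * (c₁ * ((((F.P K).L : ℝ) ^ (F.P K).d) ^ (K - n))⁻¹ / c₀)) with hCT
  have hCT0 : 0 ≤ CT := Real.sqrt_nonneg _
  have hsq : ‖T g‖ ^ 2 ≤ CT * ‖T g‖ * ‖g‖ := by
    have h1 : (‖T g‖ : ℝ) ^ 2 = RCLike.re ⟪T g, T g⟫_ℂ := by rw [← inner_self_eq_norm_sq (𝕜 := ℂ)]
    rw [h1, ← hT]
    calc RCLike.re ⟪ι (Q'' (T g)), g⟫_ℂ ≤ ‖⟪ι (Q'' (T g)), g⟫_ℂ‖ := RCLike.re_le_norm _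
      _ ≤ ‖ι (Q'' (T g))‖ * ‖g‖ := norm_inner_le_norm _ _
      _ ≤ CT * ‖T g‖ * ‖g‖ := mul_le_mul_of_nonneg_right (norm_lift_topMean_le F h hε₀ hε7 U₀ hreg Q'' hseq ι hι (T g)) (norm_nonneg _)
  by_cases h0 : ‖T g‖ = 0
  · rw [h0]; positivity
  · have hpos : 0 < ‖T g‖ := lt_of_le_of_ne (norm_nonneg _) (Ne.symm h0)
    nlinarith

include hε₀ hε7 hreg hseq hι hT in
/-- **THE COLUMN SOURCE IN `L²`**: `‖Q″†(δ_y ⊗ Y)‖ = ‖T(ι(Pi.single y Y))‖ ≤ √s·√(2c₁)·‖Y‖`. [cite: Balaban1985BackgroundPropagators, (3.16) p.393, (3.24) p.394] -/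
theorem norm_column_source_le (y : Site (F.P K) (K - n)) (Y : Matrix (Fin 2) (Fin 2) ℂ) :
    ‖T (ι (Pi.single y Y))‖ ≤ Real.sqrt ((25 / 8) * (c₁ * ((((F.P K).L : ℝ) ^ (F.P K).d) ^ (K - n))⁻¹ / c₀)) * (Real.sqrt (2 * c₁) * ‖Y‖) :=
  (norm_adjoint_apply_le F h hε₀ hε7 U₀ hreg Q'' hseq ι hι T hT _).trans
    (mul_le_mul_of_nonneg_left (norm_lift_single_le F h ι hι y Y) (Real.sqrt_nonneg _))

/-! ## §2 (D-E): the `L²` block decay of the columns -/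

include hε₀ hε7 hreg hseq hι hT ha in
/-- ★★★ **(D-E) THE `L²` BLOCK DECAY OF A COLUMN `ψ_y = G_a(Q″†(δ_y ⊗ Y))`**: for every coarse site `z`, in the Agmon window (`θ = μη`, `θ′ = 3μ`),
`‖toL2S(𝟙_{B(z)}·(toL2S⁻¹ψ_y))‖ ≤ e^{−μ(tdist z y − 3)}·8C_P²·(√s·√(2c₁)·‖Y‖)` — px5's tail ✓`norm_tail_le_of_massive_eq` with the cut-off `χ̃ := 1 − 𝟙_{B(z)}` and routeR-w2's block-distance
phase ✓`exists_blockDistanceWeight` centred at `y` (`φ = 0` on `B(y) ⊇ supp Q″†(δ_y⊗Y)` by ✓`adjoint_apply_eq_zero_off_block`; `φ ≥ μ(tdist z y − 3)` on `B(z)`).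
[cite: Balaban1985BackgroundPropagators, Thm 3.1 (3.46) p.398, (3.49) p.399; CombesThomas1973, Lemma 1 p.255] -/
theorem norm_blockCut_massiveColumn_le
    (G : SiteL2K ℂ 3 (periodsT3 F K) c₀ W₂ →ₗ[ℂ] SiteL2K ℂ 3 (periodsT3 F K) c₀ W₂)
    (hAG : ∀ f, covLapSite F n K c₀ U₀ (G f) + (a : ℂ) • T (ι (Q'' (G f))) = f)
    {μ : ℝ} (hμ : 0 ≤ μ) {δ₁ : ℝ} (hδ₁ : 0 ≤ δ₁)
    (hδ : 3 * ((eta F n K)⁻¹) ^ 2 * (Real.exp (μ * eta F n K) - 1) ^ 2 + a * ((25 / 8) * (c₁ * ((((F.P K).L : ℝ) ^ (F.P K).d) ^ (K - n))⁻¹ / c₀)) * (Real.exp (3 * μ) - 1) ^ 2 ≤ δ₁ ^ 2)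
    (hwin : Real.sqrt (max 2 (16 * c₀ * ((F.L : ℝ) ^ (K - n)) ^ 3 / (a * c₁))) * δ₁ ≤ 1 / 10)
    (y : Site (F.P K) (K - n)) (Y : Matrix (Fin 2) (Fin 2) ℂ) (z : Site (F.P K) (K - n)) :
    ‖toL2S F K c₀ (fun x => if iterBlockOf (K - n) x = z then (toL2S F K c₀).symm (G (T (ι (Pi.single y Y)))) x else 0)‖
      ≤ Real.exp (-(μ * ((Site.tdist z y : ℝ) - 3))) * (8 * Real.sqrt (max 2 (16 * c₀ * ((F.L : ℝ) ^ (K - n)) ^ 3 / (a * c₁))) ^ 2) *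
          (Real.sqrt ((25 / 8) * (c₁ * ((((F.P K).L : ℝ) ^ (F.P K).d) ^ (K - n))⁻¹ / c₀)) * (Real.sqrt (2 * c₁) * ‖Y‖)) := by
  classical
  -- the phase centred at `y`
  obtain ⟨φ, φc, -, hφb, -, hφc, hφy, hφz⟩ := exists_blockDistanceWeight F (n := n) (K := K) h y hμ
  -- the column as site functions
  set u : Site (F.P K) 0 → Matrix (Fin 2) (Fin 2) ℂ := (toL2S F K c₀).symm (G (T (ι (Pi.single y Y)))) with hu
  set f : Site (F.P K) 0 → Matrix (Fin 2) (Fin 2) ℂ := (toL2S F K c₀).symm (T (ι (Pi.single y Y))) with hf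
  have hAu : covLapSite F n K c₀ U₀ (toL2S F K c₀ u) + (a : ℂ) • T (ι (Q'' (toL2S F K c₀ u))) = toL2S F K c₀ f := by
    rw [hu, hf, LinearEquiv.apply_symm_apply, LinearEquiv.apply_symm_apply]; exact hAG _
  -- the source vanishes where the phase does not
  have hφf : ∀ x, f x ≠ 0 → φ x = 0 := by
    intro x hx
    apply hφy x
    by_contra hne
    have hzero : f x = 0 := by
      rw [hf]
      exact adjoint_apply_eq_zero_off_block F U₀ Q'' hseq ι (inner_lift_eq_zero_of_disjoint F h ι hι) T hT (Pi.single y Y) y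
        (fun y' hy' => Pi.single_eq_of_ne hy' _) x hne
    exact hx hzero
  -- the cut-off `χ̃ := 1 − 𝟙_{B(z)}`
  set χt : Site (F.P K) 0 → ℝ := fun x => if iterBlockOf (K - n) x = z then 0 else 1 with hχt
  have hχt1 : ∀ x, |1 - χt x| ≤ 1 := by
    intro x; rw [hχt]; dsimp only; split_ifs <;> norm_num
  have hR : ∀ x, χt x ≠ 1 → μ * ((Site.tdist z y : ℝ) - 3) ≤ φ x := by
    intro x hx
    have hxz : iterBlockOf (K - n) x = z := by
      by_contra hne; apply hx; rw [hχt]; dsimp only; rw [if_neg hne]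
    exact hφz z x hxz
  have htail := norm_tail_le_of_massive_eq F h hε₀ hε7 U₀ hreg Q'' hseq ι hι T hT ha φ φc (by positivity) hφb hφc hδ₁ hδ hwin χt hχt1 hR u f hφf hAu
  -- `(1 − χ̃)·u = 𝟙_{B(z)}·u`
  have hcut : (fun x => (1 - χt x) • u x) = fun x => if iterBlockOf (K - n) x = z then u x else 0 := by
    funext x; rw [hχt]; dsimp only; split_ifs <;> simp
  rw [hcut] at htail
  -- the size of the source
  have hsrc : ‖toL2S F K c₀ f‖ ≤ Real.sqrt ((25 / 8) * (c₁ * ((((F.P K).L : ℝ) ^ (F.P K).d) ^ (K - n))⁻¹ / c₀)) * (Real.sqrt (2 * c₁) * ‖Y‖) := by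
    rw [hf, LinearEquiv.apply_symm_apply]; exact norm_column_source_le F h hε₀ hε7 U₀ hreg Q'' hseq ι hι T hT y Y
  exact htail.trans (mul_le_mul_of_nonneg_left hsrc (by positivity))

/-! ## §3 (D-P): the penalty is block-local, hence decays along a column -/

include hε₀ hε7 hreg hseq hι hT ha in
/-- ★★ **(D-P) THE PENALTY IS BLOCK-LOCAL**: for EVERY `u` and every fine site `x`,
`‖(a·T(ι(Q″u)))(x)‖_{W₂} ≤ a·(5∕4)√(2c₁)∕(c₀ℓ³)·√s·‖toL2S(𝟙_{B(x)}·(toL2S⁻¹u))‖` — `Q″†Q″` commutes with the block cut at `B(x)` (✓`adjoint_topMean_cut_comm`), then V2's spike test and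
✓`norm_lift_topMean_le` on the cut field. [cite: Balaban1985BackgroundPropagators, (3.24) p.394, (3.49) p.399] -/
theorem norm_equiv_penalty_apply_le_blockCut (u : SiteL2K ℂ 3 (periodsT3 F K) c₀ W₂) (x : Site (F.P K) 0) :
    ‖WL2.equiv ℂ _ W₂ ((a : ℂ) • T (ι (Q'' u))) (siteEquiv F K x)‖
      ≤ a * ((5 / 4) * Real.sqrt (2 * c₁) * ((((F.P K).L : ℝ) ^ (F.P K).d) ^ (K - n))⁻¹ / c₀) *
          Real.sqrt ((25 / 8) * (c₁ * ((((F.P K).L : ℝ) ^ (F.P K).d) ^ (K - n))⁻¹ / c₀)) *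
          ‖toL2S F K c₀ (fun x' => if iterBlockOf (K - n) x' = iterBlockOf (K - n) x then (toL2S F K c₀).symm u x' else 0)‖ := by
  classical
  have hc₀ : 0 < c₀ := Fact.out
  set lam : Site (F.P K) 0 → Matrix (Fin 2) (Fin 2) ℂ := (toL2S F K c₀).symm u with hlam
  set ucut : SiteL2K ℂ 3 (periodsT3 F K) c₀ W₂ :=
    toL2S F K c₀ (fun x' => if iterBlockOf (K - n) x' = iterBlockOf (K - n) x then lam x' else 0) with hucut
  -- `Q″†Q″` commutes with the cut: the two adjoint images agree at `x`
  have hcomm := adjoint_topMean_cut_comm F U₀ Q'' hseq ι (inner_lift_eq_zero_of_disjoint F h ι hι) T hT lam (iterBlockOf (K - n) x)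
  have hu : toL2S F K c₀ lam = u := (toL2S F K c₀).apply_symm_apply u
  have hval : WL2.equiv ℂ _ W₂ (T (ι (Q'' ucut))) (siteEquiv F K x) = WL2.equiv ℂ _ W₂ (T (ι (Q'' u))) (siteEquiv F K x) := by
    rw [hucut, hcomm, toL2S_apply, Equiv.symm_apply_apply, if_pos rfl, hu, toL2S_symm_apply, LinearEquiv.symm_apply_apply]
  rw [WL2.equiv_smul, Pi.smul_apply, norm_smul, Complex.norm_real, Real.norm_of_nonneg ha.le]
  have h1 := norm_equiv_adjoint_apply_le F h hε₀ hε7 U₀ hreg Q'' hseq ι hι T hT (ι (Q'' ucut)) (siteEquiv F K x)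
  have h2 := norm_lift_topMean_le F h hε₀ hε7 U₀ hreg Q'' hseq ι hι ucut
  have hA0 : 0 ≤ (5 / 4) * Real.sqrt (2 * c₁) * ((((F.P K).L : ℝ) ^ (F.P K).d) ^ (K - n))⁻¹ / c₀ := by
    have := (F.P K).L_pos; positivity
  have key : ‖WL2.equiv ℂ _ W₂ (T (ι (Q'' u))) (siteEquiv F K x)‖
      ≤ (5 / 4) * Real.sqrt (2 * c₁) * ((((F.P K).L : ℝ) ^ (F.P K).d) ^ (K - n))⁻¹ / c₀ *
          (Real.sqrt ((25 / 8) * (c₁ * ((((F.P K).L : ℝ) ^ (F.P K).d) ^ (K - n))⁻¹ / c₀)) * ‖ucut‖) := by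
    rw [← hval]; exact h1.trans (mul_le_mul_of_nonneg_left h2 hA0)
  calc a * ‖WL2.equiv ℂ _ W₂ (T (ι (Q'' u))) (siteEquiv F K x)‖
      ≤ a * ((5 / 4) * Real.sqrt (2 * c₁) * ((((F.P K).L : ℝ) ^ (F.P K).d) ^ (K - n))⁻¹ / c₀ *
          (Real.sqrt ((25 / 8) * (c₁ * ((((F.P K).L : ℝ) ^ (F.P K).d) ^ (K - n))⁻¹ / c₀)) * ‖ucut‖)) := mul_le_mul_of_nonneg_left key ha.le
    _ = _ := by rw [hucut]; ring

include hε₀ hε7 hreg hseq hι hT ha in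
/-- ★★ **THE PENALTY ALONG A COLUMN DECAYS**: §3 at `u := ψ_y` composed with §2 at `z := B(x)`:
`‖(a·T(ι(Q″ψ_y)))(x)‖_{W₂} ≤ a·(5∕4)√(2c₁)∕(c₀ℓ³)·√s · e^{−μ(tdist(B(x), y) − 3)}·8C_P²·√s·√(2c₁)·‖Y‖`. [cite: Balaban1985BackgroundPropagators, Thm 3.1 (3.42)∕(3.46) pp.397–398] -/
theorem norm_equiv_penalty_column_le
    (G : SiteL2K ℂ 3 (periodsT3 F K) c₀ W₂ →ₗ[ℂ] SiteL2K ℂ 3 (periodsT3 F K) c₀ W₂)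
    (hAG : ∀ f, covLapSite F n K c₀ U₀ (G f) + (a : ℂ) • T (ι (Q'' (G f))) = f)
    {μ : ℝ} (hμ : 0 ≤ μ) {δ₁ : ℝ} (hδ₁ : 0 ≤ δ₁)
    (hδ : 3 * ((eta F n K)⁻¹) ^ 2 * (Real.exp (μ * eta F n K) - 1) ^ 2 + a * ((25 / 8) * (c₁ * ((((F.P K).L : ℝ) ^ (F.P K).d) ^ (K - n))⁻¹ / c₀)) * (Real.exp (3 * μ) - 1) ^ 2 ≤ δ₁ ^ 2)
    (hwin : Real.sqrt (max 2 (16 * c₀ * ((F.L : ℝ) ^ (K - n)) ^ 3 / (a * c₁))) * δ₁ ≤ 1 / 10)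
    (y : Site (F.P K) (K - n)) (Y : Matrix (Fin 2) (Fin 2) ℂ) (x : Site (F.P K) 0) :
    ‖WL2.equiv ℂ _ W₂ ((a : ℂ) • T (ι (Q'' (G (T (ι (Pi.single y Y))))))) (siteEquiv F K x)‖
      ≤ a * ((5 / 4) * Real.sqrt (2 * c₁) * ((((F.P K).L : ℝ) ^ (F.P K).d) ^ (K - n))⁻¹ / c₀) *
          Real.sqrt ((25 / 8) * (c₁ * ((((F.P K).L : ℝ) ^ (F.P K).d) ^ (K - n))⁻¹ / c₀)) *
          (Real.exp (-(μ * ((Site.tdist (iterBlockOf (K - n) x) y : ℝ) - 3))) * (8 * Real.sqrt (max 2 (16 * c₀ * ((F.L : ℝ) ^ (K - n)) ^ 3 / (a * c₁))) ^ 2) *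
            (Real.sqrt ((25 / 8) * (c₁ * ((((F.P K).L : ℝ) ^ (F.P K).d) ^ (K - n))⁻¹ / c₀)) * (Real.sqrt (2 * c₁) * ‖Y‖))) := by
  have h1 := norm_equiv_penalty_apply_le_blockCut F h hε₀ hε7 U₀ hreg Q'' hseq ι hι T hT ha (G (T (ι (Pi.single y Y)))) x
  have h2 := norm_blockCut_massiveColumn_le F h hε₀ hε7 U₀ hreg Q'' hseq ι hι T hT ha G hAG hμ hδ₁ hδ hwin y Y (iterBlockOf (K - n) x)
  have hA0 : 0 ≤ a * ((5 / 4) * Real.sqrt (2 * c₁) * ((((F.P K).L : ℝ) ^ (F.P K).d) ^ (K - n))⁻¹ / c₀) *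
      Real.sqrt ((25 / 8) * (c₁ * ((((F.P K).L : ℝ) ^ (F.P K).d) ^ (K - n))⁻¹ / c₀)) := by
    have := (F.P K).L_pos; have : (0:ℝ) < c₀ := Fact.out; positivity
  exact h1.trans (mul_le_mul_of_nonneg_left h2 hA0)

end Summit.QuantumFields.YangMills.Theorems.Prop7MassiveColumnBlockDecay

end
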